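import Summits.QuantumFields.YangMills.Theorems.BalabanUVNodesN15PerCubeGreenCovariant
import Summits.QuantumFields.YangMills.Theorems.BalabanUVNodesN15CovariantLandauProjection
import HarnessLib

/-!
# N15 = NE2, road (c) — PROGRAMME (PC), FILE G: THE DICTIONARY `Δ_{R_U} + a·Q′_Tᵀ Q′_T = mulVecLin (Δ′_a(U))` AND ★★★★ THE DECAY OF n15-c∕197's NAMED OBJECT `G′(U) = cGreen (cvT e U) a`
# FOR EVERY `U(m)` BOND FIELD IN BAŁABAN's PRINTED CLASS (3.35) PER CUBE (dag-n15-c g26, n15-c∕266)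

Cell `pub-ymgap`, seat `pub-ymgap-dag-n15-c` (generation g26; R134 (a), s1; HUMAN RULING D-0062; chair R424 venue).  `bears_on: R4∕N15 · K3⁸ SpineGivenEndpointR13SepCoPHV
(stmt-QuantumFields-27366)`; filed `--kind proof --supports stmt-QuantumFields-27366 --as helper` — COUNT-NEUTRAL.  Theorems only; 0 `sorry`.  Imports BY NAME n15-c∕265
`…PerCubeGreenCovariant` (`uN_scGreen_of_reg335Box`) and n15-c∕201b `…CovariantLandauProjection` (`claplA_mul_cGreen`).  Nothing in the tree is modified.

WHAT.  ★ `cgrad_transpose_mulVec` (the transposed covariant gradient is the covariant backward divergence), ★★ `covLapM_gaugePair_eq_mulVecLin` (dag-n15-w3's covariant Laplacian (3.50) of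
the transport datum `gaugePair (· + e_μ) T` IS `mulVecLin ((D_T)ᵀ D_T)` for orthogonal `T`), `isUnit_cvT`, ★★ `covLapM_add_scP_eq_mulVecLin_claplA` (`Δ_{R_U} + a·Q′_Tᵀ Q′_T =
mulVecLin (Δ′_a(U))` at `T = cvT e U`, `U` unitary, trace-form coordinates), `eq_mulVecLin_cGreen_of_comp_eq_id` (a left inverse of `mulVecLin (Δ′_a(U))` IS `mulVecLin (G′(U))`),
★★★★ `hasMaj_cGreen_of_reg335Box`: `mulVecLin (cGreen (cvT e U) (a_K(a₀,L,k)·n^{d+1})) ≤ B·e^{−(δ∕16)|y−y′|_T}` for EVERY `U(m)` site bond field in `Reg335Cube` on the boxes — the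
named covariant Green's function of road (c)'s Landau letter DECAYS for backgrounds in the printed per-cube class, with NO global gauge and NO displayed row.

HONEST FRAMING ∕ LIMITS.  Finite-dimensional algebra + FILE F; MODEL carriers (doubled-cube torus cover, one scale, unit weights, King's mass window, `U(m)` site bond fields in
trace-form coordinates, crude constants); the SHAPE of [B9] Thm 3.1 (3.42)₀ ∕ Thm 3.7 ∕ Cor. 3.6 for `G′(U)`, NOT the printed theorems; nothing of [B5]∕[B6]∕[B9] asserted.  NE2⁺ NOT
PRINTED, NOT proved; N15 of record untouched (DISCHARGED AS CONSUMED, p687738); K3⁸ OPEN; counts of record UNMOVED (typed 28∕28 · discharged 8∕27); one finite 𝕋⁴ at fixed ε per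
index — NOT infinite volume, NOT OS on ℝ⁴, NOT a mass gap, NOT Clay.  Restate-immune (no Theses import).
-/

noncomputable section

open scoped BigOperators Matrix Matrix.Norms.L2Operator

namespace Summit.QuantumFields.YangMills.BalabanUVNodes.N15.Gluing

open Real
open Literature.MathematicalPhysics.QuantumFieldTheory.Balaban1983to89
open Literature.MathematicalPhysics.QuantumFieldTheory.Balaban1983to89.B5Prop11Plancherel (Tor fine unitVec)
open Literature.MathematicalPhysics.QuantumFieldTheory.Balaban1983to89.B11SectG (BlockNorm HasMaj)
open Literature.MathematicalPhysics.QuantumFieldTheory.Balaban1983to89.B6UnitTorusCarrier (unitTorusGeo)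
open Literature.MathematicalPhysics.QuantumFieldTheory.Balaban1983to89.B9Eq335RegularityClasses (Reg335Cube)
open Literature.MathematicalPhysics.QuantumFieldTheory.King1986 (aK aK_pos)
open Literature.MathematicalPhysics.QuantumFieldTheory.King1986.Torus (blockOf)
open Literature.Barriers.QuantumFields (traceForm)
open Summit.QuantumFields.YangMills.BalabanUVNodes.N15.BackgroundLayer (covLapM covLapM_apply)
open Summit.QuantumFields.YangMills.BalabanUVNodes.N15.MatrixSpecies (mmulOp coordMat basisConst liftEquiv)
open Summit.QuantumFields.YangMills.BalabanUVNodes.N15.TwoGrid (chiCube cubeBlocks)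
open Summit.QuantumFields.YangMills.BalabanUVNodes.N15.CurvedSpecies (gaugePair gaugePair_inl gaugePair_inr uN_coordMat_conj_orthogonal)
open Summit.QuantumFields.YangMills.BalabanUVNodes.N15.CovLandau (cgrad csavg claplA cGreen cgrad_mulVec claplA_mul_cGreen)

variable {d : ℕ}

/-! ## §1 `Δ_{R_T} = (D_T)ᵀ D_T` for orthogonal transporters -/

section Dictionary

variable (M : Fin (d + 1) → ℕ) [∀ μ, NeZero (M μ)] (n : ℕ) [NeZero n] {ι : Type} [Fintype ι] [DecidableEq ι]

/-- ★ **THE TRANSPOSED COVARIANT GRADIENT IS THE COVARIANT BACKWARD DIVERGENCE**: `((D_T)ᵀω)(x, i) = Σ_ν n·(Σ_k T_ν(x − e_ν)_{ki}·ω((x − e_ν, ν), k) − ω((x, ν), i))`.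
[cite: Balaban1985BackgroundPropagators, (3.23) p.394 (shape)] -/
theorem cgrad_transpose_mulVec (T : Fin (d + 1) → Tor (fine n M) → Matrix ι ι ℝ) (ω : (Tor (fine n M) × Fin (d + 1)) × ι → ℝ) (x : Tor (fine n M)) (i : ι) :
    ((cgrad M n T)ᵀ *ᵥ ω) (x, i) = ∑ ν, (n : ℝ) * (∑ k, T ν (x - unitVec (fine n M) ν) k i * ω ((x - unitVec (fine n M) ν, ν), k) - ω ((x, ν), i)) := by
  classical
  rw [Matrix.mulVec, dotProduct, Fintype.sum_prod_type, Fintype.sum_prod_type, Finset.sum_comm]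
  refine Finset.sum_congr rfl fun ν _ => ?_
  have hz : ∀ z : Tor (fine n M), ∑ k, (cgrad M n T)ᵀ (x, i) ((z, ν), k) * ω ((z, ν), k) =
      (if z = x - unitVec (fine n M) ν then (n : ℝ) * ∑ k, T ν z k i * ω ((z, ν), k) else 0) - (if z = x then (n : ℝ) * ω ((z, ν), i) else 0) := by
    intro z
    have hiff : (x = z + unitVec (fine n M) ν) ↔ (z = x - unitVec (fine n M) ν) :=
      ⟨fun h => by rw [h, add_sub_cancel_right], fun h => by rw [h, sub_add_cancel]⟩
    simp only [Matrix.transpose_apply, cgrad, hiff]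
    have hsplit : ∀ k, (n : ℝ) * ((if z = x - unitVec (fine n M) ν then T ν z k i else 0) - (if z = x then (1 : Matrix ι ι ℝ) k i else 0)) * ω ((z, ν), k) =
        (if z = x - unitVec (fine n M) ν then (n : ℝ) * (T ν z k i * ω ((z, ν), k)) else 0) - (if z = x then (if k = i then (n : ℝ) * ω ((z, ν), k) else 0) else 0) := by
      intro k; rw [Matrix.one_apply]; split_ifs <;> ring
    rw [Finset.sum_congr rfl fun k _ => hsplit k, Finset.sum_sub_distrib]
    congr 1
    · split_ifs
      · rw [Finset.mul_sum]
      · simp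
    · split_ifs
      · simp only [Finset.sum_ite_eq', Finset.mem_univ, if_true]
      · simp
  simp_rw [hz]
  rw [Finset.sum_sub_distrib, Finset.sum_ite_eq' Finset.univ, Finset.sum_ite_eq' Finset.univ]
  simp only [Finset.mem_univ, if_true]
  ring

/-- ★★ **dag-n15-w3's COVARIANT LAPLACIAN (3.50) OF THE TRANSPORT DATUM `gaugePair (· + e_μ) T` IS `mulVecLin ((D_T)ᵀ D_T)`** for ORTHOGONAL transporters (`T_ν(x)ᵀT_ν(x) = 1`), weight
`η = n⁻¹`. [cite: Balaban1985BackgroundPropagators, (3.50) p.400, (3.23)–(3.24) p.394] -/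
theorem covLapM_gaugePair_eq_mulVecLin {T : Fin (d + 1) → Tor (fine n M) → Matrix ι ι ℝ} (hT : ∀ ν x, (T ν x)ᵀ * T ν x = 1) :
    covLapM (fun μ : Fin (d + 1) => Equiv.addRight (unitVec (fine n M) μ)) (((n : ℕ) : ℝ))⁻¹ (gaugePair (fun μ : Fin (d + 1) => Equiv.addRight (unitVec (fine n M) μ)) T) =
      Matrix.mulVecLin ((cgrad M n T)ᵀ * cgrad M n T) := by
  classical
  refine LinearMap.ext fun f => funext fun p => ?_
  obtain ⟨x, i⟩ := p
  rw [covLapM_apply, inv_inv, Matrix.mulVecLin_apply, ← Matrix.mulVec_mulVec, cgrad_transpose_mulVec]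
  simp only [gaugePair_inl, gaugePair_inr, Equiv.addRight_symm, Equiv.coe_addRight, Matrix.transpose_apply, cgrad_mulVec, ← sub_eq_add_neg, sub_add_cancel]
  -- `Σ_k T_{ki}(Σ_j T_{kj} f_j) = Σ_j (TᵀT)_{ij} f_j = f_i`
  have horth : ∀ ν, ∑ k, T ν (x - unitVec (fine n M) ν) k i * ∑ j, T ν (x - unitVec (fine n M) ν) k j * f (x, j) = f (x, i) := by
    intro ν
    have h := congrFun (congrFun (hT ν (x - unitVec (fine n M) ν)) i)
    calc ∑ k, T ν (x - unitVec (fine n M) ν) k i * ∑ j, T ν (x - unitVec (fine n M) ν) k j * f (x, j)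
        = ∑ j, ((T ν (x - unitVec (fine n M) ν))ᵀ * T ν (x - unitVec (fine n M) ν)) i j * f (x, j) := by
          simp only [Matrix.mul_apply, Matrix.transpose_apply, Finset.mul_sum, Finset.sum_mul]
          rw [Finset.sum_comm]
          exact Finset.sum_congr rfl fun j _ => Finset.sum_congr rfl fun k _ => by ring
      _ = f (x, i) := by
          simp only [h, Matrix.one_apply, ite_mul, one_mul, zero_mul, Finset.sum_ite_eq, Finset.mem_univ, if_true]
  rw [Finset.mul_sum]
  refine Finset.sum_congr rfl fun ν _ => ?_
  have e1 : ∑ k, T ν (x - unitVec (fine n M) ν) k i * ((n : ℝ) * (∑ j, T ν (x - unitVec (fine n M) ν) k j * f (x, j) - f (x - unitVec (fine n M) ν, k))) =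
      (n : ℝ) * (f (x, i) - ∑ k, T ν (x - unitVec (fine n M) ν) k i * f (x - unitVec (fine n M) ν, k)) := by
    rw [← horth ν, ← Finset.sum_sub_distrib, Finset.mul_sum]
    exact Finset.sum_congr rfl fun k _ => by ring
  rw [e1]
  ring

variable {M n}

/-- an orthogonal transporter is a unit. [folklore] -/
theorem isUnit_of_orth {T : Matrix ι ι ℝ} (h1 : Tᵀ * T = 1) (h2 : T * Tᵀ = 1) : IsUnit T := ⟨⟨T, Tᵀ, h2, h1⟩, rfl⟩

/-- a LEFT inverse of `mulVecLin (Δ′_a(T))` IS `mulVecLin (G′(T))` (n15-c∕201b `claplA_mul_cGreen`). [cite: Balaban1985BackgroundPropagators, (3.25) p.394 («G′ = G′(U) = (Δ′_a)⁻¹»)] -/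
theorem eq_mulVecLin_cGreen_of_comp_eq_id {T : Fin (d + 1) → Tor (fine n M) → Matrix ι ι ℝ} (hT : ∀ ν x, IsUnit (T ν x)) {a : ℝ} (ha : 0 < a)
    {G : (Tor (fine n M) × ι → ℝ) →ₗ[ℝ] (Tor (fine n M) × ι → ℝ)} (hG : G ∘ₗ Matrix.mulVecLin (claplA M n T a) = LinearMap.id) :
    G = Matrix.mulVecLin (cGreen M n T a) := by
  have h1 : Matrix.mulVecLin (claplA M n T a) ∘ₗ Matrix.mulVecLin (cGreen M n T a) = LinearMap.id := by
    rw [← Matrix.mulVecLin_mul, claplA_mul_cGreen M n hT ha, Matrix.mulVecLin_one]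
  calc G = G ∘ₗ (Matrix.mulVecLin (claplA M n T a) ∘ₗ Matrix.mulVecLin (cGreen M n T a)) := by rw [h1, LinearMap.comp_id]
    _ = Matrix.mulVecLin (cGreen M n T a) := by rw [← LinearMap.comp_assoc, hG, LinearMap.id_comp]

end Dictionary

/-! ## §2 The decay of `G′(U)` for `U` in the printed per-cube class -/

section Green

variable {L : ℕ} [NeZero L] {mv kk : ℕ} {hL : Odd L ∧ 1 < L} (ι : Type) [Fintype ι] [DecidableEq ι] {mm : Type} [Fintype mm] [DecidableEq mm] (e : Matrix mm mm ℂ ≃L[ℝ] (ι → ℝ))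

/-- ★★ **`Δ_{R_U} + a·Q′_Tᵀ Q′_T = mulVecLin (Δ′_a(U))`** at `T = cvT e U` for a `U(m)` site bond field `U` in trace-form coordinates (the transporters are orthogonal: dag-n15-w2
`uN_coordMat_conj_orthogonal`). [cite: Balaban1985BackgroundPropagators, (3.24) p.394, (3.50) p.400] -/
theorem covLapM_add_scP_eq_mulVecLin_claplA (he : ∀ A B : Matrix mm mm ℂ, traceForm A B = e A ⬝ᵥ e B) (a : ℝ) (U : Fin (d + 1) → ScX d L mv kk hL → Matrix mm mm ℂ)
    (hU : ∀ μ x, (U μ x)ᴴ * U μ x = 1) :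
    covLapM (scShift d L mv kk hL) ((((L ^ kk : ℕ) : ℝ))⁻¹) (gaugePair (scShift d L mv kk hL) (fun μ x => coordMat e (ContinuousLinearMap.mulLeftRight ℝ (Matrix mm mm ℂ) (U μ x) (U μ x)ᴴ))) +
        scP d L mv kk hL a ι e U = Matrix.mulVecLin (claplA (cvM d L mv kk hL) (L ^ kk) (cvT e U) a) := by
  have hT : ∀ ν x, (cvT e U ν x)ᵀ * cvT e U ν x = 1 := fun ν x => (uN_coordMat_conj_orthogonal e he (hU ν x)).1
  have h1 := covLapM_gaugePair_eq_mulVecLin (cvM d L mv kk hL) (L ^ kk) hT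
  rw [claplA, Matrix.mulVecLin_add, scP, ← h1]
  rfl

/-- the transporters of a `U(m)` field are units. [folklore] -/
theorem isUnit_cvT (he : ∀ A B : Matrix mm mm ℂ, traceForm A B = e A ⬝ᵥ e B) {X : Type} (U : Fin (d + 1) → X → Matrix mm mm ℂ) (hU : ∀ μ x, (U μ x)ᴴ * U μ x = 1) (ν : Fin (d + 1)) (x : X) :
    IsUnit (cvT e U ν x) :=
  isUnit_of_orth (uN_coordMat_conj_orthogonal e he (hU ν x)).1 (uN_coordMat_conj_orthogonal e he (hU ν x)).2

/-- ★★★★ **THE NAMED COVARIANT GREEN's FUNCTION `G′(U) = cGreen (cvT e U) a` OF ROAD (c)'s LANDAU LETTER DECAYS FOR EVERY `U(m)` BOND FIELD IN BAŁABAN's PRINTED CLASS (3.35) PER CUBE.**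
For odd `L ≥ 7`, `a₀ > 0`, a colour index `ι`: there are `δ, w₀, R₀, B > 0` such that on every doubled torus `2L·L^m` of the cover (`k ≥ 1`, `L^m ≥ w₀`), at King's mass `a_K(a₀,L,k)·(L^k)^{d+1}`, for
trace-form coordinates `e` of `𝔲(m)` and EVERY `U(m)`-valued site bond field `U` in the class `Reg335Cube (· + e_μ) U L^{−k} Q_k ξ C` on the box around every cut box, with the two explicit
(3.35) letter bounds `≤ r_V` and `r_V(1 + |J ⊕ J|) + a₀|ι|(|ι|σ² + 2σ) ≤ R₀`: `mulVecLin (G′(U)) ≤ B·e^{−(δ∕16)|y−y′|_T}` blockwise on the coloured scalar fields — NO global gauge, NO displayed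
row, no gauge in the statement.  MODEL carriers; the SHAPE of [B9] Thm 3.1 (3.42)₀ ∕ Thm 3.7 ∕ Cor. 3.6 for `G′(U)`, NOT the printed theorems.
[cite: Balaban1985BackgroundPropagators, Thm 3.1 (3.42) p.397, Thm 3.7 (3.90) p.409, Cor. 3.6 p.408, (3.24)–(3.25) p.394, (3.34)–(3.35) p.396 (shape ∕ mechanism); Balaban1984PropagatorsII, (2.91)–(2.93) p.239] -/
theorem hasMaj_cGreen_of_reg335Box (hL : Odd L ∧ 1 < L) (hL7 : 7 ≤ L) {a₀ : ℝ} (ha₀ : 0 < a₀) (ι : Type) [Fintype ι] [DecidableEq ι] :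
    ∃ δ w₀ R₀ B : ℝ, 0 < δ ∧ 0 < R₀ ∧ 0 < B ∧
      ∀ (mv kk : ℕ), 1 ≤ kk → w₀ ≤ ((L ^ mv : ℕ) : ℝ) →
      ∀ {mm : Type} [Fintype mm] [DecidableEq mm] [Nonempty mm] (e : Matrix mm mm ℂ ≃L[ℝ] (ι → ℝ)), (∀ A B : Matrix mm mm ℂ, traceForm A B = e A ⬝ᵥ e B) →
      ∀ (U : Fin (d + 1) → ScX d L mv kk hL → (Matrix mm mm ℂ)ˣ), (∀ μ x, (U μ x : Matrix mm mm ℂ) ∈ Matrix.unitaryGroup mm ℂ) →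
      ∀ (ξ C : ℝ), 0 < ξ → 0 ≤ C →
        (∀ k, Reg335Cube (scShift d L mv kk hL) U ((((L ^ kk : ℕ) : ℝ))⁻¹) {x : ScX d L mv kk hL | blockOf (L ^ kk) (cvM d L mv kk hL) x ∈ cubeBlocks (cvM d L mv kk hL) (coverCorner (cvM d L mv kk hL) (L ^ mv) L (2 * L ^ mv + 1) k) (6 * L ^ mv + 3)} ξ C) →
      ∀ (rV : ℝ), 0 ≤ rV →
        Fintype.card ι * (@basisConst ι _ (Matrix mm mm ℂ) Matrix.frobeniusNormedAddCommGroup Matrix.frobeniusNormedSpace e * (2 * Real.sqrt (Fintype.card mm)) * (Real.sqrt (Fintype.card mm) * ((C / ξ) * Real.exp (((((L ^ kk : ℕ) : ℝ))⁻¹) * (C / ξ))))) ≤ rV →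
        Fintype.card ι * (Fintype.card (Fin (d + 1)) * (Fintype.card ι * (@basisConst ι _ (Matrix mm mm ℂ) Matrix.frobeniusNormedAddCommGroup Matrix.frobeniusNormedSpace e * (2 * Real.sqrt (Fintype.card mm)) * (Real.sqrt (Fintype.card mm) * ((C / ξ) * Real.exp (((((L ^ kk : ℕ) : ℝ))⁻¹) * (C / ξ))))) ^ 2 + @basisConst ι _ (Matrix mm mm ℂ) Matrix.frobeniusNormedAddCommGroup Matrix.frobeniusNormedSpace e * (2 * Real.sqrt (Fintype.card mm)) * (Real.sqrt (Fintype.card mm) * ((C / ξ ^ 2) * Real.exp (((((L ^ kk : ℕ) : ℝ))⁻¹) * (C / ξ)))))) ≤ rV →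
        rV * (1 + Fintype.card (Fin (d + 1) ⊕ Fin (d + 1))) + a₀ * (Fintype.card ι * (Fintype.card ι * ((1 + rV * ((((L ^ kk : ℕ) : ℝ))⁻¹)) ^ ((d + 1) * L ^ kk) - 1) ^ 2 + 2 * ((1 + rV * ((((L ^ kk : ℕ) : ℝ))⁻¹)) ^ ((d + 1) * L ^ kk) - 1))) ≤ R₀ →
        HasMaj (ScNorm d L mv kk hL ι) (ScNorm d L mv kk hL ι)
            (Matrix.mulVecLin (cGreen (cvM d L mv kk hL) (L ^ kk) (cvT e (fun μ x => (U μ x : Matrix mm mm ℂ))) (aK a₀ (L : ℝ) kk * (((L ^ kk : ℕ) : ℝ)) ^ (d + 1))))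
          (fun y y' => B * Real.exp (-(δ / 16 * (unitTorusGeo L kk (cvM d L mv kk hL)).dist y y'))) := by
  obtain ⟨δ, w₀, R₀, B, hδ, hR₀, hB, H⟩ := uN_scGreen_of_reg335Box (d := d) hL hL7 ha₀ ι
  refine ⟨δ, w₀, R₀, B, hδ, hR₀, hB, fun mv kk hk hw₀ => ?_⟩
  intro mm _ _ _ e he U hU ξ C hξ hC h335 rV hrV hrA hrC hRle
  obtain ⟨w, -, hdecay, hleft, -⟩ := H mv kk hk hw₀ e he U hU ξ C hξ hC h335 rV hrV hrA hrC hRle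
  have hL1r : (1 : ℝ) < (L : ℝ) := by exact_mod_cast hL.2
  have ha' : 0 < (aK a₀ (L : ℝ) kk * (((L ^ kk : ℕ) : ℝ)) ^ (d + 1)) := mul_pos (aK_pos ha₀ hL1r hk) (by positivity)
  have hU' : ∀ μ x, ((U μ x : Matrix mm mm ℂ))ᴴ * (U μ x : Matrix mm mm ℂ) = 1 := fun μ x => Matrix.mem_unitaryGroup_iff'.mp (hU μ x)
  rw [covLapM_add_scP_eq_mulVecLin_claplA ι e he (aK a₀ (L : ℝ) kk * (((L ^ kk : ℕ) : ℝ)) ^ (d + 1)) (fun μ x => (U μ x : Matrix mm mm ℂ)) hU'] at hleft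
  rw [eq_mulVecLin_cGreen_of_comp_eq_id (isUnit_cvT ι e he (fun μ x => (U μ x : Matrix mm mm ℂ)) hU') ha' hleft] at hdecay
  exact hdecay

end Green



end Summit.QuantumFields.YangMills.BalabanUVNodes.N15.Gluing

end
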